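import Summits.ABC.ABC.Theses.CubicResolventAllowance
import Literature.NumberTheory.DiophantineApproximation.SPartPolynomialValues
import HarnessLib

/-!
# STUB-IDEAS `stub_complexCubic` · ideator k1 · generation 11 — index DEPTH, not index SIZE

Crux stmt-ABC-22740 `CubicResolventAllowance.IndexSzpiro`, stub `stub_complexCubic` (the `d_K < 0` half),
route-ABC-CubicResolventAllowance. FAMILY 1 (recognise & import), gen 11. Elaboration sketch for the page
`STUB-IDEAS-stub_complexCubic-1.md`: statements (helper lemmas = `sorry` bodies, sized on the page) and the
kernel-checked algebra of the Frey–Hellegouarch dictionary `E_{x,y} : Y² = X³ − 3H(x,y)X + G(x,y)`,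
`Δ = 2⁴3⁶·disc(F)·F(x,y)²`, 2-division cubic of `E_{1,0}` = `27a²·F((X−b)/3a, 1)` (Bennett–Dahmen 2013 (20)–(23)).

What is imported (both SIGN-BLIND, hence valid verbatim on the complex class `d_K < 0`):
* R — Ridout 1958 / Mahler 1961 = Bugeaud–Evertse–Győry 2018 Prop. 3.1 for cubic forms
  (`|F(u,v)| / [F(u,v)]_S ≫_{F,S,ε} max(|u|,|v|)^{1−ε}`): Szpiro with exponent `6κ + ε` and constant `C(K,ε)` on the
  curves of the `K`-class whose 2-division index has DEPTH `≤ κ` at the primes outside `2d_K`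
  (`v_p(Δ_min) ≤ 2κ`); `κ = 1`: Szpiro `6 + ε` on the squarefree-index slice, every cubic `K`, either sign.
* BD — Bennett–Dahmen 2013 Thm. 8.4 (i) (+ Darmon–Granville 1995 Thm. 1): for `K` whose index form omits
  `S_K`-units (first instances are COMPLEX cubic fields, `d_K = −2063, −2423, …`), on the one-outside-prime slice the
  depth is `≤ 3` beyond `p₀(K)`: `v_p(Δ_min) ≤ 6` — a LOCAL Szpiro-6 at the lone prime; with R: global `18 + ε`.
Neither reaches the stub (constants `C(K,ε)`, ineffective and not uniform in `K`; the stub wants `C(ε)·|d_K|`).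
-/

set_option linter.dupNamespace false

noncomputable section

namespace Summit.ABC.ABC.Cruxes.IndexSzpiro.StubIdeasComplexCubic1G11

open Polynomial WeierstrassCurve
open Literature.NumberTheory.DiophantineApproximation (sPart)

/-- The stub, verbatim (payload `stub.signature`; = `IndexSzpiro` with the extra hypothesis `d_K < 0`). -/
def Stub : Prop :=
  ∀ ε : ℝ, 0 < ε → ∃ C : ℝ, ∀ (W : WeierstrassCurve ℚ) [W.IsElliptic] (K : Type) [Field K] [NumberField K],
    Irreducible W.twoTorsionPolynomial.toPoly → Module.finrank ℚ K = 3 →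
    (∃ θ : K, aeval θ W.twoTorsionPolynomial.toPoly = 0) → NumberField.discr K < 0 →
    (W.minimalDiscriminantNorm ℤ : ℝ) ≤ C * |(NumberField.discr K : ℝ)| * (W.conductorNorm ℤ : ℝ) ^ (6 + ε)

/-- The route crux gives the stub (drop the sign hypothesis). [folklore] -/
theorem stub_of_indexSzpiro (h : Summit.ABC.ABC.Theses.CubicResolventAllowance.IndexSzpiro) : Stub := by
  intro ε hε
  obtain ⟨C, hC⟩ := h ε hε
  exact ⟨C, fun W _ K _ _ hirr h3 hθ _ => hC W K hirr h3 hθ⟩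

/-! ## §F  Binary cubic forms: covariants, syzygy, Frey–Hellegouarch curve (kernel-checked algebra) -/

section Covariants

variable {R : Type*} [CommRing R]

/-- The binary cubic form `F = a x³ + b x²y + c xy² + d y³`. -/
def cf (a b c d x y : R) : R := a * x ^ 3 + b * x ^ 2 * y + c * x * y ^ 2 + d * y ^ 3

/-- Its discriminant `Δ_F = b²c² − 4ac³ − 4b³d − 27a²d² + 18abcd`. -/
def cfDisc (a b c d : R) : R :=
  b ^ 2 * c ^ 2 - 4 * a * c ^ 3 - 4 * b ^ 3 * d - 27 * a ^ 2 * d ^ 2 + 18 * a * b * c * d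

/-- The (sign-normalised) Hessian covariant `H = (b² − 3ac)x² + (bc − 9ad)xy + (c² − 3bd)y²`. -/
def cfH (a b c d x y : R) : R :=
  (b ^ 2 - 3 * a * c) * x ^ 2 + (b * c - 9 * a * d) * x * y + (c ^ 2 - 3 * b * d) * y ^ 2

/-- The cubic (Jacobian) covariant `G`, normalised by `G(1,0) = 2b³ − 9abc + 27a²d`. -/
def cfG (a b c d x y : R) : R :=
  (2 * b ^ 3 - 9 * a * b * c + 27 * a ^ 2 * d) * x ^ 3 + 3 * (b ^ 2 * c - 6 * a * c ^ 2 + 9 * a * b * d) * x ^ 2 * y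
    - 3 * (b * c ^ 2 - 6 * b ^ 2 * d + 9 * a * c * d) * x * y ^ 2 - (2 * c ^ 3 - 9 * b * c * d + 27 * a * d ^ 2) * y ^ 3

/-- F1 (kernel-checked). The classical syzygy `G² = 4H³ − 27·Δ_F·F²`. [folklore] -/
theorem cf_syzygy (a b c d x y : R) :
    cfG a b c d x y ^ 2 = 4 * cfH a b c d x y ^ 3 - 27 * cfDisc a b c d * cf a b c d x y ^ 2 := by
  unfold cfG cfH cfDisc cf
  ring

end Covariants

/-- The Frey–Hellegouarch curve of the form `(a,b,c,d)` at `(x,y)`: `Y² = X³ − 3H(x,y)·X + G(x,y)`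
(Bennett–Dahmen 2013, (20) with `n = 2`, up to their normalisation of `H`). -/
def fhCurve (a b c d x y : ℤ) : WeierstrassCurve ℚ :=
  ⟨0, 0, 0, -3 * cfH (a : ℚ) b c d x y, cfG (a : ℚ) b c d x y⟩

/-- F2 (kernel-checked). `Δ(E_{x,y}) = 2⁴·3⁶·Δ_F·F(x,y)²` — the discriminant of the Frey–Hellegouarch curve is the
form's discriminant times the SQUARE of the represented value: primes outside `6Δ_F` are bad iff they divide
`F(x,y)`. [folklore] -/
theorem fhCurve_Δ (a b c d x y : ℤ) :
    (fhCurve a b c d x y).Δ = 2 ^ 4 * 3 ^ 6 * cfDisc (a : ℚ) b c d * cf (a : ℚ) b c d x y ^ 2 := by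
  simp only [fhCurve, WeierstrassCurve.Δ, WeierstrassCurve.b₂, WeierstrassCurve.b₄, WeierstrassCurve.b₆,
    WeierstrassCurve.b₈]
  unfold cfG cfH cfDisc cf
  ring

/-- F3 (kernel-checked). Constant 2-torsion: if `aθ³ + bθ² + cθ + d = 0` then `3aθ + b` is a root of the
2-division polynomial of `E_{1,0}` (`X³ − 3H(1,0)X + G(1,0) = 27a²·F((X − b)/3a, 1)`), so the 2-division
field of `E_{1,0}` is the field of the form. [folklore] -/
theorem fhCurve_twoTorsion_root (a b c d : ℤ) {K : Type} [Field K] [Algebra ℚ K] (θ : K)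
    (hθ : (a : K) * θ ^ 3 + b * θ ^ 2 + c * θ + d = 0) :
    aeval (3 * (a : K) * θ + b) (fhCurve a b c d 1 0).twoTorsionPolynomial.toPoly = 0 := by
  simp only [fhCurve, WeierstrassCurve.twoTorsionPolynomial, Cubic.toPoly, WeierstrassCurve.b₂,
    WeierstrassCurve.b₄, WeierstrassCurve.b₆]
  unfold cfH cfG
  simp only [map_add, map_mul, map_pow, map_sub, map_neg, aeval_X, map_ofNat, map_zero, map_intCast, mul_zero,
    add_zero]
  linear_combination (108 * (a : K) ^ 2) * hθ

/-! ## §E  Eligibility (Bennett–Dahmen's hypothesis) in form language and in curve language -/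

/-- E0. `u₀` is a (non-zero) `S_F`-unit numerator: every prime factor of `u₀` divides `2·Δ_F`. -/
def SuppIn (D u₀ : ℤ) : Prop := u₀ ≠ 0 ∧ ∀ p : ℕ, p.Prime → (p : ℤ) ∣ u₀ → (p : ℤ) ∣ 2 * D

/-- E1. Bennett–Dahmen eligibility of the form: `F` never represents an `S_F`-unit on coprime pairs
(`S_F` = primes of `2Δ_F`). Fails for every index form of a MONOGENIC field (`F(x₀,y₀) = ±1`); holds for no
form with `|Δ_F| ≤ 1000` and first for the COMPLEX cubic form `3x³ + 2x²y + 5xy² + 3y³`, `Δ_F = −2063`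
(B–D Thm. 1.1 and p. 174). [cite: BennettDahmen2013, Thm. 1.1, pp. 173–174] -/
def FormEligible (a b c d : ℤ) : Prop :=
  ∀ x y : ℤ, IsCoprime x y → ∃ p : ℕ, p.Prime ∧ ¬ ((p : ℤ) ∣ 2 * cfDisc a b c d) ∧ (p : ℤ) ∣ cf a b c d x y

/-- E2. Field eligibility: every integral irreducible cubic form of discriminant `d_K` with a root in `K`
(= the index form of `𝓞_K` up to `GL₂(ℤ)`, Delone–Faddeev) is eligible. -/
def FieldEligible (K : Type) [Field K] [NumberField K] : Prop :=
  ∀ a b c d : ℤ, a ≠ 0 → Irreducible (C (a : ℚ) * X ^ 3 + C (b : ℚ) * X ^ 2 + C (c : ℚ) * X + C (d : ℚ)) →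
    cfDisc a b c d = NumberField.discr K → (∃ θ : K, (a : K) * θ ^ 3 + b * θ ^ 2 + c * θ + d = 0) →
    FormEligible a b c d

/-- E3. Curve eligibility (the same hypothesis read on the route's class): every curve of the `K`-class has a bad
prime outside `2·d_K`. -/
def CurveEligible (K : Type) [Field K] [NumberField K] : Prop :=
  ∀ (W : WeierstrassCurve ℚ) [W.IsElliptic], Irreducible W.twoTorsionPolynomial.toPoly →
    (∃ θ : K, aeval θ W.twoTorsionPolynomial.toPoly = 0) →
    ∃ p : ℕ, p.Prime ∧ ¬ ((p : ℤ) ∣ 2 * NumberField.discr K) ∧ p ∣ W.conductorNorm ℤ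

/-! ## §D  The dictionary class ↔ (index form, primitive pair, content) -/

/-- D1 (M; from gen-5 `K5_exists_index_sq_eq`: `2⁸Δ_min = I_E²·|d_K|`, plus an integral basis of `𝓞_K`:
`I_E = [𝓞_K : ℤ[η]] = m³·|F_K(u,v)|` for `η = x₀ + m(uω₁ + vω₂)`). Every curve of the `K`-class is indexed by an
irreducible integral cubic form of discriminant `d_K` with a root in `K`, a COPRIME pair `(u,v)` and a content
`m ≥ 1`, with `2⁸·Δ_min(E) = m⁶ · F(u,v)² · |d_K|`. [folklore] -/
def ClassIndexForm : Prop :=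
  ∀ (W : WeierstrassCurve ℚ) [W.IsElliptic] (K : Type) [Field K] [NumberField K],
    Irreducible W.twoTorsionPolynomial.toPoly → Module.finrank ℚ K = 3 →
    (∃ θ : K, aeval θ W.twoTorsionPolynomial.toPoly = 0) →
    ∃ a b c d u v : ℤ, ∃ m : ℕ, a ≠ 0 ∧
      Irreducible (C (a : ℚ) * X ^ 3 + C (b : ℚ) * X ^ 2 + C (c : ℚ) * X + C (d : ℚ)) ∧
      cfDisc a b c d = NumberField.discr K ∧ (∃ θ : K, (a : K) * θ ^ 3 + b * θ ^ 2 + c * θ + d = 0) ∧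
      IsCoprime u v ∧ 0 < m ∧
      (2 : ℤ) ^ 8 * (W.minimalDiscriminantNorm ℤ : ℤ) = (m : ℤ) ^ 6 * cf a b c d u v ^ 2 * |NumberField.discr K| ∧
      (∀ q : ℕ, q.Prime → q ≠ 2 → q ∣ m → q ^ 2 ∣ W.conductorNorm ℤ)

/-- D2 (M). The two eligibilities agree: `CurveEligible K ↔ FieldEligible K` for cubic `K`
(→: the Frey–Hellegouarch curve `E_{u,v}` of the index form lies in the class by F3 + covariance, and its bad primes
outside `2d_K` divide `F(u,v)` by F2 after the twist removing `3⁶`; ←: D1 and "odd primes of `F(u,v)` are bad").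
[folklore] -/
theorem curveEligible_iff_fieldEligible (hD : ClassIndexForm) (K : Type) [Field K] [NumberField K]
    (hK : Module.finrank ℚ K = 3) : CurveEligible K ↔ FieldEligible K := by
  sorry

/-! ## §R  PLAN A — Ridout: Szpiro exponent `6κ` on index depth `≤ κ` (every cubic `K`, either sign) -/

/-- R0 (NAMED-FACT SHAPE; M from the tree's `padicRoth_int_of_rat` hypothesis `hRat` = Bombieri–Gubler Thm. 6.2.3
for `ℚ`, exactly as `SPartPolynomialValuesProofs` does for the univariate Thm. 2.1 (i)). Bugeaud–Evertse–Győry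
2018, Prop. 3.1 (Mahler 1961, from Ridout 1958), cubic case: for an integral binary cubic form with non-zero
discriminant, a finite set of primes `S` and `ε > 0`, `|F(x,y)| / [F(x,y)]_S ≥ c·max(|x|,|y|)^{1−ε}` on coprime
pairs with `F(x,y) ≠ 0`, `c = c(F,S,ε) > 0` ineffective.
[cite: BugeaudEvertseGyory2018, Prop. 3.1 (arXiv:1708.08290 §3); Ridout1958; BombieriGubler2006 Thm. 6.2.3] -/
def BEG2018_prop_3_1_cubic : Prop :=
  ∀ a b c d : ℤ, cfDisc a b c d ≠ 0 → ∀ S : Finset ℕ, (∀ p ∈ S, p.Prime) →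
    ∀ ε : ℝ, 0 < ε → ∃ c₀ : ℝ, 0 < c₀ ∧ ∀ x y : ℤ, IsCoprime x y → cf a b c d x y ≠ 0 →
      c₀ * (max |(x : ℝ)| |(y : ℝ)|) ^ (1 - ε) ≤ |(cf a b c d x y : ℝ)| / (sPart S (cf a b c d x y) : ℝ)

/-- R1. DEPTH-GRADED SZPIRO on a fixed class (statement): if every prime `p ∤ 2d_K` has `v_p(Δ_min(E)) ≤ 2κ`
(the 2-division index has depth `≤ κ` outside `S_K`), then `Δ_min(E) ≤ C(K,κ,ε)·N_E^{6κ+ε}`.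
`κ = 1`: Szpiro `6 + ε` on the squarefree-index slice. -/
def DepthGradedSzpiro (K : Type) [Field K] [NumberField K] (κ : ℕ) : Prop :=
  ∀ ε : ℝ, 0 < ε → ∃ C : ℝ, ∀ (W : WeierstrassCurve ℚ) [W.IsElliptic],
    Irreducible W.twoTorsionPolynomial.toPoly → (∃ θ : K, aeval θ W.twoTorsionPolynomial.toPoly = 0) →
    (∀ p : ℕ, p.Prime → ¬ ((p : ℤ) ∣ 2 * NumberField.discr K) → padicValNat p (W.minimalDiscriminantNorm ℤ) ≤ 2 * κ) →
    (W.minimalDiscriminantNorm ℤ : ℝ) ≤ C * (W.conductorNorm ℤ : ℝ) ^ (6 * (κ : ℝ) + ε)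

/-- R2 (M). `R0 ∧ D1 ⇒ DepthGradedSzpiro K κ` for every cubic `K` (EITHER sign) and every `κ ≥ 1`.
Proof: D1 gives `2⁸Δ_min = m⁶F(u,v)²|d_K|`; depth `≤ κ` outside `S = primes(2d_K)` forces `m` to be `S`-supported,
and minimality bounds `v_q(m)` (`≤ 1` for `q ∤ 6`), so `m ≤ M_K`; write `|F(u,v)| = u₀·s`, `u₀ = [F(u,v)]_S`,
`s = ∏_{p ∉ S} p^{k_p}`, `k_p ≤ κ`, every such `p` bad, so `s ≤ N^κ`; R0: `s ≥ c₀ H^{1−ε'}`, `H = max(|u|,|v|)`;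
`|F(u,v)| ≤ (|a|+|b|+|c|+|d|) H³`; hence `Δ_min ≤ C_K H⁶ ≤ C s^{6+ε} ≤ C N^{6κ+ε}`. [folklore] -/
theorem depthGradedSzpiro_of_ridout (hR : BEG2018_prop_3_1_cubic) (hD : ClassIndexForm)
    (K : Type) [Field K] [NumberField K] (hK : Module.finrank ℚ K = 3) {κ : ℕ} (hκ : 1 ≤ κ) :
    DepthGradedSzpiro K κ := by
  sorry

/-- R3 (S, PROVED). The stub implies the `κ = 1` statement uniformly (indeed without the depth hypothesis):
the rung lies BELOW the stub. [folklore] -/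
theorem depthGradedSzpiro_one_of_stub (h : Stub) (K : Type) [Field K] [NumberField K]
    (hK : Module.finrank ℚ K = 3) (hneg : NumberField.discr K < 0) : DepthGradedSzpiro K 1 := by
  intro ε hε
  obtain ⟨C, hC⟩ := h ε hε
  refine ⟨C * |(NumberField.discr K : ℝ)|, fun W _ hirr hθ _ => ?_⟩
  have h1 := hC W K hirr hK hθ hneg
  have h6 : (6 * ((1 : ℕ) : ℝ) + ε) = 6 + ε := by push_cast; ring
  rw [h6]
  exact h1

/-! ## §B  PLAN B — Bennett–Dahmen: depth `≤ 3` on the one-outside-prime slice (eligible `K`, either sign) -/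

/-- B0 (NAMED-FACT SHAPE). Bennett–Dahmen 2013, Thm. 8.4 (i) with (41), index `n = 2` (cubic forms, `F̃ = F`):
for an irreducible integral binary cubic form `F` that omits `S_F`-units on coprime pairs (this excludes the theorem's
alternatives (ii)/(iii)), every solution of `F(x,y) = u₀ z^ℓ`, `gcd(x,y) = 1`, `z ≠ 0`, `u₀ ∈ ℤ*_{S_F}`, `ℓ` prime,
has `log ℓ < c · (∏_{p ∣ 2Δ_F} p²) · (∑_{p ∣ 2Δ_F} log p)` with an ABSOLUTE effective `c` (the proof's
"WLOG `ℓ > 163`" is absorbed in `c`). Modular method: Frey–Hellegouarch curves with CONSTANT 2-torsion, level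
lowering to `N₁ ∣ 2⁸3⁵∏_{p∣Δ_F} p²`, Prop. 8.3 / Lemma 8.2 (Martin's dimension bound).
[cite: BennettDahmen2013, Thm. 8.4 (i), (41), Prop. 8.1 (35)–(36), pp. 195–198] -/
def BennettDahmen2013_thm_8_4_cubic : Prop :=
  ∃ c₁ : ℝ, 0 < c₁ ∧ ∀ a b c d : ℤ, a ≠ 0 →
    Irreducible (C (a : ℚ) * X ^ 3 + C (b : ℚ) * X ^ 2 + C (c : ℚ) * X + C (d : ℚ)) → FormEligible a b c d →
    ∀ x y z u₀ : ℤ, ∀ ℓ : ℕ, IsCoprime x y → z ≠ 0 → SuppIn (cfDisc a b c d) u₀ → ℓ.Prime →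
      cf a b c d x y = u₀ * z ^ ℓ →
      Real.log ℓ < c₁ * (∏ p ∈ (2 * cfDisc a b c d).natAbs.primeFactors, ((p : ℝ) ^ 2)) *
        ∑ p ∈ (2 * cfDisc a b c d).natAbs.primeFactors, Real.log p

/-- B0' (NAMED-FACT SHAPE). Darmon–Granville 1995, Thm. 1, cubic case with coefficient: for a binary cubic form with
non-zero discriminant, `c₀ ≠ 0` and FIXED `m ≥ 4` (`1/3·(1 − 1/m)·… `: genus `≥ 2`), `F(x,y) = c₀ z^m` has finitely
many coprime solutions `(x,y)` (Faltings; ineffective). The tree holds only Thm. 2 (`darmonGranville1995_thm_2`).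
[cite: DarmonGranville1995, Thm. 1; BennettDahmen2013 p. 174 ("finitely many solutions with l ≥ 4")] -/
def DarmonGranville1995_thm_1_cubic : Prop :=
  ∀ a b c d c₀ : ℤ, cfDisc a b c d ≠ 0 → c₀ ≠ 0 → ∀ m : ℕ, 4 ≤ m →
    {t : ℤ × ℤ | IsCoprime t.1 t.2 ∧ ∃ z : ℤ, cf a b c d t.1 t.2 = c₀ * z ^ m}.Finite

/-- B1. LOCAL SZPIRO-6 AT THE LONE PRIME (statement): beyond `p₀(K)`, a curve of the `K`-class whose bad primes
outside `2d_K` reduce to ONE multiplicative prime `p` has `v_p(Δ_min) ≤ 6` (`= 6·v_p(N)`). Sharp: depth `3`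
occurs in infinite families (`F(x,y) = u₀z³` is a genus-1 curve; k3 gen 4). -/
def LocalSzpiroOnePrimeSlice (K : Type) [Field K] [NumberField K] : Prop :=
  ∃ p₀ : ℕ, ∀ (W : WeierstrassCurve ℚ) [W.IsElliptic],
    Irreducible W.twoTorsionPolynomial.toPoly → (∃ θ : K, aeval θ W.twoTorsionPolynomial.toPoly = 0) →
    ∀ p : ℕ, p.Prime → p₀ ≤ p → ¬ ((p : ℤ) ∣ 2 * NumberField.discr K) →
      (∀ q : ℕ, q.Prime → q ∣ W.conductorNorm ℤ → (q : ℤ) ∣ 2 * NumberField.discr K ∨ q = p) →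
      ¬ (p ^ 2 ∣ W.conductorNorm ℤ) →
      padicValNat p (W.minimalDiscriminantNorm ℤ) ≤ 6

/-- B2 (M). `B0 ∧ B0' ∧ D1 ⇒` for every cubic `K` (EITHER SIGN) with `FieldEligible K`: `LocalSzpiroOnePrimeSlice K`.
Proof: D1: `2⁸Δ_min = m⁶F(u,v)²|d_K|`, `p ∤ m` (multiplicative at `p` ⇒ `v_p(c₄) = 0`, while odd `q ∣ m ⇒ q ∣ c₄`),
so `v_p(Δ_min) = 2k`, `F(u,v) = ±u₀p^k`, `u₀ ∈ ℤ*_S`. If `k ≥ 4` pick `n ∣ k` with `n ∈ {4,6,9} ∪ {primes ≥ 5}`: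
a prime `n = ℓ` is `≤ L_K := exp(c₁R_K)` by B0; for the finitely many `n ∈ {4,6,9} ∪ [5, L_K]` and the finitely many
`u₁ ∈ ℤ*_S/(ℤ*_S)^n`, B0' makes `(u,v)` range in a finite set `T_K`, so `p ≤ max |F(T_K)| =: p₀(K) − 1`. [folklore] -/
theorem localSzpiroOnePrimeSlice_of_BD (hBD : BennettDahmen2013_thm_8_4_cubic)
    (hDG : DarmonGranville1995_thm_1_cubic) (hD : ClassIndexForm) (K : Type) [Field K] [NumberField K]
    (hK : Module.finrank ℚ K = 3) (hel : FieldEligible K) : LocalSzpiroOnePrimeSlice K := by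
  sorry

/-- B3 (S). On the one-outside-prime slice, B1 (depth `≤ 3` at `p`, the only prime outside `2d_K`) feeds R1 with
`κ = 3`: `Δ_min ≤ C(K,ε)·N^{18+ε}` there — the honest global payoff of Bennett–Dahmen (NOT exponent `6`: the
`S_K`-part `u₀²m⁶` of `Δ_min` is controlled only by Ridout, `u₀ ≤ C p^{2k+ε}`). [folklore] -/
theorem onePrimeSlice_eighteen (K : Type) [Field K] [NumberField K] (hloc : LocalSzpiroOnePrimeSlice K)
    (hdepth : DepthGradedSzpiro K 3) :
    ∃ p₀ : ℕ, ∀ ε : ℝ, 0 < ε → ∃ C : ℝ, ∀ (W : WeierstrassCurve ℚ) [W.IsElliptic],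
      Irreducible W.twoTorsionPolynomial.toPoly → (∃ θ : K, aeval θ W.twoTorsionPolynomial.toPoly = 0) →
      ∀ p : ℕ, p.Prime → p₀ ≤ p → ¬ ((p : ℤ) ∣ 2 * NumberField.discr K) →
        (∀ q : ℕ, q.Prime → q ∣ W.conductorNorm ℤ → (q : ℤ) ∣ 2 * NumberField.discr K ∨ q = p) →
        ¬ (p ^ 2 ∣ W.conductorNorm ℤ) →
        (W.minimalDiscriminantNorm ℤ : ℝ) ≤ C * (W.conductorNorm ℤ : ℝ) ^ (18 + ε) := by
  obtain ⟨p₀, hp₀⟩ := hloc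
  refine ⟨p₀, fun ε hε => ?_⟩
  obtain ⟨C, hC⟩ := hdepth ε hε
  refine ⟨C, fun W _ hirr hθ p hp hp₀p hpS hslice hmult => ?_⟩
  have h18 : (6 * ((3 : ℕ) : ℝ) + ε) = 18 + ε := by push_cast; ring
  rw [← h18]
  refine hC W hirr hθ (fun q hq hqS => ?_)
  by_cases hqp : q = p
  · subst hqp
    simpa using hp₀ W hirr hθ q hq hp₀p hqS hslice hmult
  · -- `q ∤ 2d_K`, `q ≠ p`: `q` is not bad, so `v_q(Δ_min) = 0 ≤ 6`
    sorry

end Summit.ABC.ABC.Cruxes.IndexSzpiro.StubIdeasComplexCubic1G11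

end
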